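import Literature.AlgebraicGeometry.HodgeTheory.SemiregularVariationalHodge
import Literature.AlgebraicGeometry.HodgeTheory.DirectImageBaseChange
import Literature.AlgebraicGeometry.HodgeTheory.MotivatedClassesDeformationInputs
import Literature.AlgebraicGeometry.KTheory.PullbackVectorBundle
import Literature.AlgebraicGeometry.Motives.ComplexPointsEtaleLocalHomeomorph
import HarnessLib

/-!
# Buchweitz–Flenner 2003, Thm. 5.1: the conclusion from a deformation over an ÉTALE neighbourhood (proved)

Family `hodge`, layer `Literature/AlgebraicGeometry/HodgeTheory`. Companion of
`SemiregularVariationalHodge.lean` (the NAMED FACT `BuchweitzFlenner2003_variationalHodge_semiregular`,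
BF Thm. 5.1 for `I = {1, 2}`, is not discharged here). The printed proof (Compositio Math. 137
(2003), §5, p. 27 of the arXiv text) has two halves:

1. (deformation theory — NOT formalised) `ℰ_0` lifts to all infinitesimal neighbourhoods of `0`
   in `S` (Prop. 5.9, Lemma 5.10: `I`-semiregularity and the horizontality of `ch_I`), whence, by a
   versal deformation and "Artin's approximation theorem", a coherent `S`-flat `ℱ` over a
   neighbourhood of `0` inducing `ℰ_0`. For an ALGEBRAIC family `π : 𝒳 ⟶ S` the output of Artin
   approximation is a deformation of `ℰ_0` over an ÉTALE neighbourhood `g : (S', s'₀) → (S, s₀)` —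
   a finite locally free `ℱ` on `𝒳 ×_S S'` restricting to `ℰ_0` on the fibre
   `(𝒳 ×_S S')_{s'₀} ≅ X_{s₀}` (cf. Perry 2026, Thm. 1.1 (1): "`E_0` deforms […] over an étale
   neighborhood of `0`").
2. (the last step — PROVED here) "the uniqueness of the horizontal lifting gives that
   `α_p = ch_p(ℱ)` […] Hence `α_p(s) = ch_p(ℱ|X_s)` is algebraic for all `s ∈ S` near `0`":
   `conclusion_of_etaleLocal_iso_pullback` — given the output of 1, there is an open `W ∋ s₀` inside
   `U` (the image of a chart of the local homeomorphism `g(ℂ)`, SGA 1 XII 3.1 (iii),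
   `Motives.ComplexPoints.isLocalHomeomorph_map`) such that along every path in `W` from `s₀` the
   transport of `ch_p(ℰ_0)` is an algebraic class of the fibre reached, in EVERY degree `p`: lift
   the path to `S'(ℂ)` through the chart, compare the transports in `𝒳/S` and `𝒳 ×_S S'/S'`
   (`FiberClass.baseChange_transportFun`, file `DirectImageBaseChange`: `R π_* ℂ` commutes with base
   change along a local homeomorphism; Ehresmann for the base-changed family,
   `isCohomologicallyLocallyTrivialOn_univ`), and use that restrictions of the global class
   `ch_p(ℱ)` are flat (`transportFun_map_fiberι`) and Chern characters of vector bundles on smooth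
   projective fibres are algebraic (`ChernCharacterBetti.map_ch`, `ch_mem_algebraicClasses`).
   `….of_etaleLocal_iso_pullback` is the instance in the exact shape of the fact's conclusion
   (degrees `1` and `2`). The special case `S' = S` is
   `BuchweitzFlenner2003_variationalHodge_semiregular.conclusion_of_iso_pullback` of the main file.

So the fact is reduced, sorry-free, to half 1: the EXISTENCE of a finite locally free deformation
of the `{0,1}`-semiregular `ℰ_0` over an étale neighbourhood of `s₀` when `ch₁`, `ch₂` stay of
Hodge type — BF §3 (Atiyah-class obstruction calculus over artinian bases), §5 Prop. 5.9 /
Lemma 5.10 (with Bloch's criterion Lemma 5.7 and the Gauss–Manin connection), versality and Artin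
approximation; none of these is in the tree or in Mathlib.

Hypotheses on the bases (all satisfied by an affine étale neighbourhood of a point of a smooth
separated `S`): `S`, `S'` smooth of the same relative dimension `m`, locally of finite type and
separated over `ℂ`, `S'` quasi-compact, `g` smooth (hence étale).

## References

* [BuchweitzFlenner2003] R.-O. Buchweitz, H. Flenner, A semiregularity map for modules and
  applications to deformations, Compositio Math. 137 (2003), §5 Thm. 5.1 and its proof (p. 27).
* [Perry2026Semiregularity] A. Perry, arXiv:2604.00511 (2026), Thm. 1.1 (1).
* [Artin1969] M. Artin, Algebraic approximation of structures over complete local rings, Publ.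
  Math. IHÉS 36 (1969), Thm. 1.10 / Cor. 2.1 (the étale neighbourhood).
* [SGA1] A. Grothendieck, M. Raynaud, SGA 1, Exp. XII, Prop. 3.1 (iii).
* [VoisinHodgeII2003] C. Voisin, Hodge Theory and Complex Algebraic Geometry II, §3.1.2.
-/

noncomputable section

open CategoryTheory AlgebraicGeometry
open _root_.Topology _root_.Filter
open Literature.AlgebraicTopology.SingularHomology

namespace Literature.AlgebraicGeometry.HodgeTheory

section HodgeTheory

variable (C : ChernCharacterBetti) {𝒳 S S' : Motives.SchemeOver ℂ} (π : 𝒳 ⟶ S) (g : S' ⟶ S)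

/-- **The Chern character of the deformation, read on a fibre of the original family, is
algebraic**: for `ℱ` finite locally free on `𝒳 ×_S S'` and `s' ∈ S'(ℂ)`,
`(X_{g s'} ≅ X'_{s'})^* (ch_p(ℱ)|_{X'_{s'}}) = ch_p(ℱ|_{X_{g s'}})` is an algebraic class of the smooth
projective fibre `X_{g s'}`. [cite: BuchweitzFlenner2003, §5, proof of Thm. 5.1] -/
theorem map_inv_map_fiberι_ch_mem_algebraicClasses {n : ℕ} (hπ : Motives.IsSmoothProjectiveFamily π n)
    (ℱ : (Motives.familyPullback π g).left.Modules) (hℱ : Motives.IsFiniteLocallyFree ℱ)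
    (s' : Motives.ComplexPoints S') (p : ℕ) :
    complexBetti.map (Motives.fiberOverFamilyPullbackIso π g s').inv (2 * p)
        (complexBetti.map (Motives.fiberι (Motives.familyPullback.snd π g) s') (2 * p)
          (C.ch (Motives.familyPullback π g) ℱ p)) ∈
      algebraicClasses (Motives.fiberOver π (Motives.AlgPoints.map g s')) p := by
  have h : complexBetti.map (Motives.fiberOverFamilyPullbackIso π g s').inv (2 * p)
      (complexBetti.map (Motives.fiberι (Motives.familyPullback.snd π g) s') (2 * p)
        (C.ch (Motives.familyPullback π g) ℱ p)) =
      C.ch (Motives.fiberOver π (Motives.AlgPoints.map g s'))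
        ((Scheme.Modules.pullback ((Motives.fiberOverFamilyPullbackIso π g s').inv ≫
          Motives.fiberι (Motives.familyPullback.snd π g) s').left).obj ℱ) p := by
    rw [← C.map_ch _ ℱ hℱ.isVectorBundle p, complexBetti.map_comp]
    rfl
  rw [h]
  exact C.ch_mem_algebraicClasses (hπ.isSmoothProjective _) _
    (hℱ.pullback _).isVectorBundle p

/-- **BF Thm. 5.1, the last step, for a deformation over an étale neighbourhood (all degrees).**
Let `π : 𝒳 ⟶ S` be a smooth projective family, `g : S' ⟶ S` étale (smooth between smooth
`ℂ`-schemes of the same dimension `m`; `S`, `S'` locally of finite type and separated, `S'`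
quasi-compact), `U ⊆ S(ℂ)` cohomologically locally trivial with `g(s'₀) ∈ U`, and `ℱ` a finite
locally free module on `𝒳 ×_S S'` whose restriction to the fibre over `s'₀`, read on `X_{g s'₀}`, is
`E₀`. Then on the open `W = φ.target ∩ U ∋ g(s'₀)` (`φ` a chart of the local homeomorphism `g(ℂ)`
at `s'₀`) the transport of `ch_p(E₀)` along every path in `W` from `g(s'₀)` is an algebraic class
of the fibre reached, for every `p` ("`α_p(s) = ch_p(ℱ|X_s)` is algebraic for all `s` near `0`").
[cite: BuchweitzFlenner2003, §5, proof of Thm. 5.1] [cite: SGA1, Exp. XII Prop. 3.1 (iii)] -/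
theorem BuchweitzFlenner2003_variationalHodge_semiregular.conclusion_of_etaleLocal_iso_pullback
    {n : ℕ} (m : ℕ) (hπ : Motives.IsSmoothProjectiveFamily π n)
    [SmoothOfRelativeDimension m S.hom] [LocallyOfFiniteType S.hom] [IsSeparated S.hom]
    [SmoothOfRelativeDimension m S'.hom] [LocallyOfFiniteType S'.hom] [IsSeparated S'.hom]
    [CompactSpace S'.left] [Smooth g.left]
    {U : Set (Motives.ComplexPoints S)} (hU : IsCohomologicallyLocallyTrivialOn π U)
    (s₀' : Motives.ComplexPoints S') (h₀ : Motives.AlgPoints.map g s₀' ∈ U)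
    (E₀ : (Motives.fiberOver π (Motives.AlgPoints.map g s₀')).left.Modules)
    (ℱ : (Motives.familyPullback π g).left.Modules) (hℱ : Motives.IsFiniteLocallyFree ℱ)
    (e : E₀ ≅ (Scheme.Modules.pullback ((Motives.fiberOverFamilyPullbackIso π g s₀').inv ≫
      Motives.fiberι (Motives.familyPullback.snd π g) s₀').left).obj ℱ) :
    ∃ (W : Set (Motives.ComplexPoints S)) (hWo : IsOpen W) (hW₀ : Motives.AlgPoints.map g s₀' ∈ W)
      (hWU : W ⊆ U),
      ∀ (t : W) (γ : Path.Homotopic.Quotient (⟨Motives.AlgPoints.map g s₀', hW₀⟩ : W) t) (p : ℕ),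
        transportFun π (2 * p) (hU.mono hWU hWo) γ
            (C.ch (Motives.fiberOver π (Motives.AlgPoints.map g s₀')) E₀ p) ∈
          algebraicClasses (Motives.fiberOver π t.1) p := by
  -- the base-changed family is smooth projective; Ehresmann makes `R π'_* ℂ` a local system on `S'(ℂ)`
  have hπ' : Motives.IsSmoothProjectiveFamily (Motives.familyPullback.snd π g) n :=
    hπ.familyPullback_snd g
  haveI := hπ'.smoothOfRelativeDimension
  haveI := hπ'.isProper
  have hU' : IsCohomologicallyLocallyTrivialOn (Motives.familyPullback.snd π g)
      (Set.univ : Set (Motives.ComplexPoints S')) :=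
    isCohomologicallyLocallyTrivialOn_univ (Motives.familyPullback.snd π g) n m
  -- `g(ℂ)` is a local homeomorphism; a chart at `s₀'`
  have hg : IsLocalHomeomorph
      (Motives.AlgPoints.map g : Motives.ComplexPoints S' → Motives.ComplexPoints S) :=
    Motives.ComplexPoints.isLocalHomeomorph_map m g
  obtain ⟨φ, hs₀φ, hφ⟩ := hg s₀'
  have hgs₀ : Motives.AlgPoints.map g s₀' = φ s₀' := congrFun hφ s₀'
  have hW₀ : Motives.AlgPoints.map g s₀' ∈ φ.target ∩ U :=
    ⟨by rw [hgs₀]; exact φ.map_source hs₀φ, h₀⟩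
  refine ⟨φ.target ∩ U, φ.open_target.inter hU.isOpen, hW₀, Set.inter_subset_right, ?_⟩
  intro t γ p
  induction γ using Quotient.ind with | _ γ => ?_
  -- lift `γ` to `S'(ℂ)` through the chart
  have hγc : Continuous fun u => φ.symm (γ u).1 :=
    φ.continuousOn_symm.comp_continuous (continuous_subtype_val.comp γ.continuous)
      fun u => (γ u).2.1
  let γ' : Path (⟨s₀', Set.mem_univ _⟩ : (Set.univ : Set (Motives.ComplexPoints S')))
      ⟨φ.symm t.1, Set.mem_univ _⟩ :=
    { toFun := fun u => ⟨φ.symm (γ u).1, Set.mem_univ _⟩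
      continuous_toFun := hγc.subtype_mk _
      source' := by
        apply Subtype.ext
        change φ.symm (γ 0).1 = s₀'
        rw [γ.source]
        change φ.symm (Motives.AlgPoints.map g s₀') = s₀'
        rw [hgs₀, φ.left_inv hs₀φ]
      target' := by
        apply Subtype.ext
        change φ.symm (γ 1).1 = φ.symm t.1
        rw [γ.target] }
  have hγ : ∀ u, Motives.AlgPoints.map g (γ' u).1 = (γ u).1 := fun u => by
    change Motives.AlgPoints.map g (φ.symm (γ u).1) = (γ u).1
    exact (congrFun hφ _).trans (φ.right_inv (γ u).2.1)
  -- the class `ch_p(ℱ)|_{X'_{s₀'}}` transfers to `ch_p(E₀)`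
  set α' : complexBetti (Motives.fiberOver (Motives.familyPullback.snd π g) s₀') (2 * p) :=
    complexBetti.map (Motives.fiberι (Motives.familyPullback.snd π g) s₀') (2 * p)
      (C.ch (Motives.familyPullback π g) ℱ p) with hα'
  have hα : C.ch (Motives.fiberOver π (Motives.AlgPoints.map g s₀')) E₀ p =
      complexBetti.map (Motives.fiberOverFamilyPullbackIso π g s₀').inv (2 * p) α' := by
    rw [hα', C.ch_congr e, ← C.map_ch _ ℱ hℱ.isVectorBundle p, complexBetti.map_comp]
    rfl
  have h₀ : (⟨Motives.AlgPoints.map g s₀', C.ch (Motives.fiberOver π (Motives.AlgPoints.map g s₀')) E₀ p⟩ :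
      FiberClass π (2 * p)) = FiberClass.baseChange π g (2 * p) ⟨s₀', α'⟩ := by
    rw [hα]
    rfl
  -- transport commutes with base change
  have key := FiberClass.baseChange_transportFun π g (2 * p) hg
    (hU.mono Set.inter_subset_right (φ.open_target.inter hU.isOpen)) hU' γ γ' hγ α' h₀
  -- the transport in the base-changed family is the restriction of the global class `ch_p(ℱ)`
  have htr : transportFun (Motives.familyPullback.snd π g) (2 * p) hU' ⟦γ'⟧ α' =
      complexBetti.map (Motives.fiberι (Motives.familyPullback.snd π g) (φ.symm t.1)) (2 * p)
        (C.ch (Motives.familyPullback π g) ℱ p) :=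
    transportFun_map_fiberι (Motives.familyPullback.snd π g) (2 * p) hU' ⟦γ'⟧ _
  rw [htr] at key
  exact (FiberClass.prop_iff_of_mk_eq
    (fun t x => x ∈ algebraicClasses (Motives.fiberOver π t) p) key).2
    (map_inv_map_fiberι_ch_mem_algebraicClasses C π g hπ ℱ hℱ (φ.symm t.1) p)

/-- **The fact's conclusion (degrees `1` and `2`, its exact shape) from a deformation over an
étale neighbourhood**: with the base point written `g(s'₀)`, an extension `ℱ` of `ℰ_0` to
`𝒳 ×_S S'` (the output of BF's Prop. 5.9 + Artin approximation, or of Perry's Thm. 1.1 (1) when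
untwisted) yields the open `W ∋ g(s'₀)` of `BuchweitzFlenner2003_variationalHodge_semiregular`, with
no semiregularity or Hodge-type hypothesis left — they are consumed by the existence of `ℱ`.
[cite: BuchweitzFlenner2003, §5, proof of Thm. 5.1] -/
theorem BuchweitzFlenner2003_variationalHodge_semiregular.of_etaleLocal_iso_pullback
    {n : ℕ} (m : ℕ) (hπ : Motives.IsSmoothProjectiveFamily π n)
    [SmoothOfRelativeDimension m S.hom] [LocallyOfFiniteType S.hom] [IsSeparated S.hom]
    [SmoothOfRelativeDimension m S'.hom] [LocallyOfFiniteType S'.hom] [IsSeparated S'.hom]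
    [CompactSpace S'.left] [Smooth g.left]
    {U : Set (Motives.ComplexPoints S)} (hU : IsCohomologicallyLocallyTrivialOn π U)
    (s₀' : Motives.ComplexPoints S') (h₀ : Motives.AlgPoints.map g s₀' ∈ U)
    (E₀ : (Motives.fiberOver π (Motives.AlgPoints.map g s₀')).left.Modules)
    (ℱ : (Motives.familyPullback π g).left.Modules) (hℱ : Motives.IsFiniteLocallyFree ℱ)
    (e : E₀ ≅ (Scheme.Modules.pullback ((Motives.fiberOverFamilyPullbackIso π g s₀').inv ≫
      Motives.fiberι (Motives.familyPullback.snd π g) s₀').left).obj ℱ) :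
    ∃ (W : Set (Motives.ComplexPoints S)) (hWo : IsOpen W) (hW₀ : Motives.AlgPoints.map g s₀' ∈ W)
      (hWU : W ⊆ U),
      ∀ (t : W) (γ : Path.Homotopic.Quotient (⟨Motives.AlgPoints.map g s₀', hW₀⟩ : W) t),
        transportFun π (2 * 1) (hU.mono hWU hWo) γ
              (C.ch (Motives.fiberOver π (Motives.AlgPoints.map g s₀')) E₀ 1) ∈
            algebraicClasses (Motives.fiberOver π t.1) 1 ∧
          transportFun π (2 * 2) (hU.mono hWU hWo) γ
              (C.ch (Motives.fiberOver π (Motives.AlgPoints.map g s₀')) E₀ 2) ∈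
            algebraicClasses (Motives.fiberOver π t.1) 2 := by
  obtain ⟨W, hWo, hW₀, hWU, h⟩ :=
    BuchweitzFlenner2003_variationalHodge_semiregular.conclusion_of_etaleLocal_iso_pullback C π g m
      hπ hU s₀' h₀ E₀ ℱ hℱ e
  exact ⟨W, hWo, hW₀, hWU, fun t γ => ⟨h t γ 1, h t γ 2⟩⟩

end HodgeTheory

end Literature.AlgebraicGeometry.HodgeTheory

end
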